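import Summits.AtomisticToContinuum.HydrodynamicLimit.Theorems.CorrectorPressureDecay.Negative.OrthMomentumTools
import Summits.AtomisticToContinuum.HydrodynamicLimit.Theorems.BoltzmannGreenKubo.Negative.EnergyFloor

/-!
# `CorrectorPressureDecay` — tools for (a.1″): temperature-tilted Gaussian integrals and the even energy witness

Support file for crux `stmt-AtomisticToContinuum-14135` (`AntiMazurCoboundaries.CorrectorPressureDecay`, "X"),
written by the standing disprover (cdisprove seat, cycle 2); consumed by `Negative/OrthEnergy.lean`.

* §A coordinates of the standard Gaussian on `ℝ³` are independent standard Gaussians: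
  `integral_prod_coord_stdGaussian` (`map_pi_eq_stdGaussian` + `integral_fintype_prod_eq_prod`);
* §B the cooled Gaussian: `integral_exp_neg_mul_sq_gaussianReal` (`∫ e^{−cx²/2} dγ₁ = (1+c)^{−1/2}`) and the scaling
  identity `integral_mul_exp_neg_mul_sq_gaussianReal` (`∫ f(x) e^{−cx²/2} dγ₁ = (1+c)^{−1/2} ∫ f((1+c)^{−1/2}y) dγ₁`);
* §C the EVEN witness profile `hE(u) = u/(10+u)` of `u = x²`: bounds, the first-order cooling response
  `hE(u) − hE(λu) ≥ (1−λ)(u/10 − u²/50)`, and `E γ₁[x²] = 1`;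
* §D `abs_mul_exp_le`: `|x|eˣ ≤ C e^C + 1` for `x ≤ C` (integrability of a bounded-above tilt under its own tilted law).

All `[folklore]`.
-/

noncomputable section

open MeasureTheory ProbabilityTheory Set Filter Topology
open scoped ENNReal

namespace Summit.AtomisticToContinuum.HydrodynamicLimit.Theorems.CorrectorPressureDecayNegative.OrthEnergy

open Literature.MathematicalPhysics.KineticTheory (V3)

/-! ## §A Coordinates of `γ₃` are i.i.d. `γ₁` -/

/-- Products of coordinate functions integrate coordinatewise against the standard Gaussian on `ℝ³`. [folklore] -/
theorem integral_prod_coord_stdGaussian (f : Fin 3 → ℝ → ℝ) (hf : ∀ k, Measurable (f k)) :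
    ∫ w, ∏ k, f k (w k) ∂stdGaussian V3 = ∏ k, ∫ x, f k x ∂gaussianReal 0 1 := by
  have hmeas : Measurable (fun w : V3 => ∏ k, f k (w k)) :=
    Finset.measurable_prod _ fun k _ => (hf k).comp (EuclideanSpace.proj (𝕜 := ℝ) k).continuous.measurable
  rw [← map_pi_eq_stdGaussian, integral_map (PiLp.continuous_toLp 2 _).measurable.aemeasurable
    hmeas.aestronglyMeasurable]
  have : (fun x : Fin 3 → ℝ => ∏ k, f k ((WithLp.toLp 2 x : V3) k)) = fun x => ∏ k, f k (x k) := by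
    funext x
    simp
  rw [this]
  exact integral_fintype_prod_eq_prod f

/-- `e^{−c‖w‖²/2} = ∏ₖ e^{−c wₖ²/2}` on `ℝ³`. [folklore] -/
theorem exp_neg_mul_norm_sq_eq_prod (c : ℝ) (w : V3) :
    Real.exp (-(c / 2) * ‖w‖ ^ 2) = ∏ k : Fin 3, Real.exp (-(c / 2) * (w k) ^ 2) := by
  rw [BoltzmannGreenKuboForallN.norm_sq_eq_three, Fin.prod_univ_three, ← Real.exp_add, ← Real.exp_add]
  congr 1
  ring

/-! ## §B The cooled one-dimensional Gaussian -/

/-- `∫ e^{−cx²/2} dγ₁ = (√(1+c))⁻¹` for `c > −1`. [folklore] -/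
theorem integral_exp_neg_mul_sq_gaussianReal {c : ℝ} (hc : -1 < c) :
    ∫ x, Real.exp (-(c / 2) * x ^ 2) ∂gaussianReal 0 1 = (Real.sqrt (1 + c))⁻¹ := by
  rw [integral_gaussianReal_eq_integral_smul one_ne_zero]
  simp only [smul_eq_mul, gaussianPDFReal_def, NNReal.coe_one, mul_one, sub_zero]
  have hpt : ∀ x : ℝ, (Real.sqrt (2 * Real.pi))⁻¹ * Real.exp (-x ^ 2 / 2) * Real.exp (-(c / 2) * x ^ 2) =
      (Real.sqrt (2 * Real.pi))⁻¹ * Real.exp (-((1 + c) / 2) * x ^ 2) := by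
    intro x
    rw [mul_assoc, ← Real.exp_add]
    congr 2
    ring
  simp_rw [hpt]
  rw [integral_const_mul, integral_gaussian ((1 + c) / 2)]
  have h1c : 0 < 1 + c := by linarith
  have h2π : (0 : ℝ) ≤ 2 * Real.pi := by positivity
  have hs : Real.sqrt (2 * Real.pi) ≠ 0 := (Real.sqrt_pos.2 (by positivity)).ne'
  rw [show Real.pi / ((1 + c) / 2) = 2 * Real.pi / (1 + c) by field_simp, Real.sqrt_div h2π]
  field_simp

/-- **Scaling identity**: `∫ f(x) e^{−cx²/2} dγ₁ = s ∫ f(s y) dγ₁(y)`, `s = (√(1+c))⁻¹`, `c > −1` (the law `γ₁` tilted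
by `−cx²/2` is `N(0, 1/(1+c))`, the law of `sZ`). [folklore] -/
theorem integral_mul_exp_neg_mul_sq_gaussianReal (f : ℝ → ℝ) {c : ℝ} (hc : -1 < c) :
    ∫ x, f x * Real.exp (-(c / 2) * x ^ 2) ∂gaussianReal 0 1 =
      (Real.sqrt (1 + c))⁻¹ * ∫ y, f ((Real.sqrt (1 + c))⁻¹ * y) ∂gaussianReal 0 1 := by
  set s : ℝ := (Real.sqrt (1 + c))⁻¹ with hs
  have h1c : 0 < 1 + c := by linarith
  have hsq : Real.sqrt (1 + c) ^ 2 = 1 + c := Real.sq_sqrt h1c.le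
  have hsqpos : 0 < Real.sqrt (1 + c) := Real.sqrt_pos.2 h1c
  have hspos : 0 < s := by rw [hs]; positivity
  rw [integral_gaussianReal_eq_integral_smul one_ne_zero, integral_gaussianReal_eq_integral_smul one_ne_zero]
  simp only [smul_eq_mul, gaussianPDFReal_def, NNReal.coe_one, mul_one, sub_zero]
  -- `G(y) = pdf(y) f(s y)`; the left integrand is `G(s⁻¹ x)`
  set G : ℝ → ℝ := fun y => (Real.sqrt (2 * Real.pi))⁻¹ * Real.exp (-y ^ 2 / 2) * f (s * y) with hG
  have hleft : ∀ x : ℝ, (Real.sqrt (2 * Real.pi))⁻¹ * Real.exp (-x ^ 2 / 2) * (f x * Real.exp (-(c / 2) * x ^ 2)) =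
      G (s⁻¹ * x) := by
    intro x
    have hx : s * (s⁻¹ * x) = x := by rw [← mul_assoc, mul_inv_cancel₀ hspos.ne', one_mul]
    simp only [hG, hx]
    have : Real.exp (-x ^ 2 / 2) * Real.exp (-(c / 2) * x ^ 2) = Real.exp (-(s⁻¹ * x) ^ 2 / 2) := by
      rw [← Real.exp_add]
      congr 1
      rw [hs, inv_inv, mul_pow, hsq]
      ring
    calc (Real.sqrt (2 * Real.pi))⁻¹ * Real.exp (-x ^ 2 / 2) * (f x * Real.exp (-(c / 2) * x ^ 2))
        = (Real.sqrt (2 * Real.pi))⁻¹ * (Real.exp (-x ^ 2 / 2) * Real.exp (-(c / 2) * x ^ 2)) * f x := by ring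
      _ = (Real.sqrt (2 * Real.pi))⁻¹ * Real.exp (-(s⁻¹ * x) ^ 2 / 2) * f x := by rw [this]
  simp_rw [hleft]
  rw [Measure.integral_comp_mul_left G s⁻¹, inv_inv, abs_of_pos hspos, smul_eq_mul]

/-! ## §C The even witness profile -/

/-- The bounded increasing profile `hE(u) = u/(10 + u)` (of `u = x² ≥ 0`). -/
def hE (u : ℝ) : ℝ := u / (10 + u)

/-- `0 ≤ hE(u) ≤ 1` for `u ≥ 0`. [folklore] -/
theorem hE_bounds {u : ℝ} (hu : 0 ≤ u) : 0 ≤ hE u ∧ hE u ≤ 1 := by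
  have hden : 0 < 10 + u := by linarith
  refine ⟨div_nonneg hu hden.le, ?_⟩
  rw [hE, div_le_one hden]
  linarith

/-- **First-order cooling response**: `hE(u) − hE(λu) ≥ (1 − λ)(u/10 − u²/50)` for `0 ≤ λ ≤ 1`, `u ≥ 0`. [folklore] -/
theorem hE_sub_hE_mul_ge {u lam : ℝ} (hu : 0 ≤ u) (hl0 : 0 ≤ lam) (hl1 : lam ≤ 1) :
    (1 - lam) * (u / 10 - u ^ 2 / 50) ≤ hE u - hE (lam * u) := by
  have hden : 0 < 10 + u := by linarith
  have hden' : 0 < 10 + lam * u := by nlinarith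
  -- exact difference
  have hdiff : hE u - hE (lam * u) = 10 * u * (1 - lam) / ((10 + u) * (10 + lam * u)) := by
    rw [hE, hE, div_sub_div _ _ hden.ne' hden'.ne']
    congr 1
    ring
  rw [hdiff]
  -- lower the denominator: `(10+u)(10+λu) ≤ (10+u)²`, and `10u/(10+u)² ≥ u/10 − u²/50`
  have hstep1 : 10 * u * (1 - lam) / ((10 + u) * (10 + u)) ≤ 10 * u * (1 - lam) / ((10 + u) * (10 + lam * u)) := by
    apply div_le_div_of_nonneg_left (by nlinarith) (by positivity)
    exact mul_le_mul_of_nonneg_left (by nlinarith) hden.le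
  refine le_trans ?_ hstep1
  rw [le_div_iff₀ (by positivity)]
  nlinarith [mul_nonneg hu hu, mul_nonneg (mul_nonneg hu hu) hu, sub_nonneg.2 hl1, mul_nonneg hu (sub_nonneg.2 hl1)]

/-- `E γ₁[x²] = 1` (second derivative of the mgf `t ↦ e^{t²/2}` at `0`). [folklore] -/
theorem integral_sq_gaussianReal : ∫ x, x ^ 2 ∂gaussianReal 0 1 = 1 := by
  have h1 : ∫ x, x ^ 2 ∂gaussianReal 0 1 = iteratedDeriv 2 (mgf (fun x => x) (gaussianReal 0 1)) 0 := by
    rw [iteratedDeriv_mgf_zero] <;> simp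
  rw [h1, mgf_fun_id_gaussianReal]
  have hf : (fun t : ℝ => Real.exp (0 * t + ((1 : NNReal) : ℝ) * t ^ 2 / 2)) = fun t => Real.exp (t ^ 2 / 2) := by
    funext t; simp
  rw [hf]
  have hq : ∀ t : ℝ, HasDerivAt (fun t : ℝ => t ^ 2 / 2) t t := by
    intro t
    have h := (hasDerivAt_pow 2 t).div_const 2
    refine h.congr_deriv ?_
    norm_num
  have e0 : ∀ t : ℝ, HasDerivAt (fun t : ℝ => Real.exp (t ^ 2 / 2)) (Real.exp (t ^ 2 / 2) * t) t :=
    fun t => (hq t).exp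
  have d1 : deriv (fun t : ℝ => Real.exp (t ^ 2 / 2)) = fun t => Real.exp (t ^ 2 / 2) * t :=
    funext fun t => (e0 t).deriv
  have hp1 : ∀ t : ℝ, HasDerivAt (fun t : ℝ => t) 1 t := fun t => hasDerivAt_id' t
  have e1 : ∀ t : ℝ, HasDerivAt (fun t : ℝ => Real.exp (t ^ 2 / 2) * t)
      (Real.exp (t ^ 2 / 2) * t * t + Real.exp (t ^ 2 / 2) * 1) t := fun t => (e0 t).mul (hp1 t)
  have d2 : deriv (fun t : ℝ => Real.exp (t ^ 2 / 2) * t) = fun t => Real.exp (t ^ 2 / 2) * (1 + t ^ 2) := by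
    funext t
    rw [(e1 t).deriv]
    ring
  rw [iteratedDeriv_succ, iteratedDeriv_one, d1, d2]
  norm_num

/-! ## §D Integrability of a bounded-above tilt under its own tilted law -/

/-- `|x| eˣ ≤ C e^C + 1` for `x ≤ C`, `0 ≤ C`. [folklore] -/
theorem abs_mul_exp_le {x C : ℝ} (hC : 0 ≤ C) (hx : x ≤ C) : |x| * Real.exp x ≤ C * Real.exp C + 1 := by
  rcases le_or_gt 0 x with h0 | h0
  · rw [abs_of_nonneg h0]
    have : x * Real.exp x ≤ C * Real.exp C :=
      mul_le_mul hx (Real.exp_le_exp.2 hx) (Real.exp_pos _).le hC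
    linarith
  · rw [abs_of_neg h0]
    have h1 : -x ≤ Real.exp (-x) := by linarith [Real.add_one_le_exp (-x)]
    have h2 : -x * Real.exp x ≤ Real.exp (-x) * Real.exp x :=
      mul_le_mul_of_nonneg_right h1 (Real.exp_pos _).le
    rw [← Real.exp_add, neg_add_cancel, Real.exp_zero] at h2
    have h3 : 0 ≤ C * Real.exp C := by positivity
    linarith

end Summit.AtomisticToContinuum.HydrodynamicLimit.Theorems.CorrectorPressureDecayNegative.OrthEnergy

end
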